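import Literature.Analysis.FluidPDE.PlanarMovingChain
import HarnessLib

/-!
# Fully frozen chains: the diagonal well-formedness of a moving chain

Topic `Literature/Analysis/FluidPDE`. Continuation of `PlanarMovingChain.lean`. There the
well-formedness `MovingChain.WFB` asks, at every time `s`, the banded well-formedness of the chain
`M.frozen s` whose BOXES are frozen at `s` while the junction STEPS keep moving — so its order
conditions compare boxes at time `s` with steps at every other time `t`, which fails for sliding
designs (box and steps of a sliding element translate together). Only the diagonal `t = s` is ever
used. This file freezes the steps as well: `M.frozenAt s` has the boxes at `s` AND constant step
positions `(M.J j).pos s`, and the bands are replaced by their time slices at `s`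
(`bandSlice Band s k = {p | (s, p.2) ∈ Band k}`); its cut-offs at any time agree with the moving
cut-offs at time `s` (`frozenAt_chi`). The **diagonal well-formedness** `MovingChain.WFBd Band`
asks `(M.frozenAt s).WFB (bandSlice Band s)` for every `s`, smooth edges and step positions, and
closed space-time bands; from it the whole packaging of `PlanarMovingChain.lean` is re-derived
verbatim: smooth cut-offs, open cores / junction regions, closed tube boxes, `IsRegionData`, and on
a slot `S × Q` the transport of the assembled move, the bound, vanishing off the boxes / tubes and
the identification on cores (`WFBd.transport_move`, …).

Folklore; no named facts. Infrastructure towards a discharge of `acm_compatible_blocks`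
(`QuasiSelfSimilarCompatibleBlocks.lean`); the typed chains of the Level-4 emitter are certified
through `WFBd`.

## References

* G. Alberti, G. Crippa, A. L. Mazzucato, *Exponential self-similar mixing by incompressible
  flows*, J. Amer. Math. Soc. 32 (2019), 445–490, §§7–8 (arXiv:1605.02090).
-/

noncomputable section

open Function Set Filter
open scoped Topology ContDiff

namespace Literature.Analysis.FluidPDE

namespace PlanarKinematics

open Gluing

/-- The plane `ℝ²` as a Euclidean space. [folklore] -/
local notation "E²" => EuclideanSpace ℝ (Fin 2)

namespace JStep

/-- **The step frozen at time `s`**: constant breakpoint `pos s`. [folklore] -/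
def frzAt (J : JStep) (s : ℝ) : JStep := ⟨J.axis, J.sgn, fun _ => J.pos s, J.len⟩

/-- The argument of the frozen step at any time is the argument at time `s`. [folklore] -/
@[simp] theorem frzAt_arg (J : JStep) (s t : ℝ) (z : E²) : (J.frzAt s).arg t z = J.arg s z := rfl

/-- The value of the frozen step at any time is the value at time `s`. [folklore] -/
@[simp] theorem frzAt_val (J : JStep) (s t : ℝ) (z : E²) : (J.frzAt s).val t z = J.val s z := rfl

/-- The frozen step has a constant, hence smooth, breakpoint. [folklore] -/
theorem frzAt_pos_contDiff (J : JStep) (s : ℝ) : ContDiff ℝ ∞ (J.frzAt s).pos := contDiff_const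

end JStep

namespace MovingChain

variable (M : MovingChain)

/-- **The fully frozen chain at time `s`**: boxes at `s` and constant step positions `pos s`. [folklore] -/
def frozenAt (s : ℝ) : ChainData := ⟨M.K, fun k => (M.box k).frz s, fun j => (M.J j).frzAt s⟩

/-- Its number of elements. [folklore] -/
@[simp] theorem frozenAt_K (s : ℝ) : (M.frozenAt s).K = M.K := rfl

/-- Its boxes. [folklore] -/
@[simp] theorem frozenAt_B (s : ℝ) (k : ℕ) : (M.frozenAt s).B k = (M.box k).frz s := rfl

/-- Its steps. [folklore] -/
@[simp] theorem frozenAt_J (s : ℝ) (j : ℕ) : (M.frozenAt s).J j = (M.J j).frzAt s := rfl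

/-- Out-steps of the fully frozen chain are the out-steps at time `s`. [folklore] -/
theorem frozenAt_sigmaOut (s t : ℝ) (k : ℕ) (z : E²) : (M.frozenAt s).sigmaOut k t z = (M.frozen s).sigmaOut k s z := by
  unfold ChainData.sigmaOut
  rfl

/-- In-steps of the fully frozen chain are the in-steps at time `s`. [folklore] -/
theorem frozenAt_sigmaIn (s t : ℝ) (k : ℕ) (z : E²) : (M.frozenAt s).sigmaIn k t z = (M.frozen s).sigmaIn k s z := by
  unfold ChainData.sigmaIn
  rw [frozenAt_sigmaOut]

/-- **The cut-offs of the fully frozen chain (at any time) are the moving cut-offs at time `s`.**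
[folklore] -/
theorem frozenAt_chi (s t : ℝ) (k : ℕ) (z : E²) : (M.frozenAt s).chi k t z = M.chi k s z := by
  rw [chi_apply, ChainData.chi_apply, ChainData.chi_apply, frozenAt_sigmaIn, frozenAt_sigmaOut]
  rfl

/-- **Time slice of a space-time band at time `s`** (as a space-time set, constant in time). [folklore] -/
def bandSlice (Band : ℕ → Set (ℝ × E²)) (s : ℝ) (k : ℕ) : Set (ℝ × E²) := {p | (s, p.2) ∈ Band k}

/-- Membership in a slice. [folklore] -/
@[simp] theorem mem_bandSlice (Band : ℕ → Set (ℝ × E²)) (s : ℝ) (k : ℕ) (p : ℝ × E²) :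
    p ∈ bandSlice Band s k ↔ (s, p.2) ∈ Band k := Iff.rfl

/-- **Diagonal (banded) well-formedness of a moving chain**: at every time the FULLY frozen chain is
banded well-formed with respect to the band slices; edges and step positions move smoothly; the
space-time bands are closed. [folklore] -/
structure WFBd (Band : ℕ → Set (ℝ × E²)) : Prop where
  /-- every fully frozen chain is banded well-formed for the sliced bands -/
  frozenAt : ∀ s, (M.frozenAt s).WFB (bandSlice Band s)
  /-- edges move smoothly -/
  smooth : ∀ k < M.K, (M.box k).Smooth
  /-- step positions move smoothly -/
  pos_smooth : ∀ j, j + 1 < M.K → ContDiff ℝ ∞ (M.J j).pos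
  /-- space-time bands are closed -/
  isClosed_band : ∀ k < M.K, IsClosed (Band k)

variable {M} {Band : ℕ → Set (ℝ × E²)}

/-- Positivity of the transition lengths (read off any frozen chain). [folklore] -/
theorem WFBd.ρ_pos (h : M.WFBd Band) {k : ℕ} (hk : k < M.K) : 0 < (M.box k).ρ := (h.frozenAt 0).ρ_pos k hk

/-- Step positions are continuous. [folklore] -/
theorem WFBd.pos_continuous (h : M.WFBd Band) {j : ℕ} (hj : j + 1 < M.K) : Continuous (M.J j).pos :=
  (h.pos_smooth j hj).continuous

/-! ## Smoothness of the cut-offs and topology of the regions -/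

/-- **The cut-offs of a diagonally well-formed moving chain are smooth** (for `k < K`). [folklore] -/
theorem WFBd.contDiff_uncurry_chi (h : M.WFBd Band) {k : ℕ} (hk : k < M.K) : ContDiff ℝ ∞ (uncurry (M.chi k)) := by
  have hτ : ContDiff ℝ ∞ fun p : ℝ × E² => ((M.box k).frz p.1).val p.2 := (M.box k).contDiff_uncurry_val (h.smooth k hk)
  have hout : ∀ m, ContDiff ℝ ∞ (uncurry ((M.frozen 0).sigmaOut m)) := by
    intro m
    unfold ChainData.sigmaOut
    split_ifs with hm
    · exact (M.J m).contDiff_uncurry_val (h.pos_smooth m hm)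
    · exact contDiff_const
  have hin : ContDiff ℝ ∞ (uncurry ((M.frozen 0).sigmaIn k)) := by
    unfold ChainData.sigmaIn
    split_ifs
    · exact contDiff_const
    · exact hout _
  have e : uncurry (M.chi k) = fun p : ℝ × E² =>
      ((M.box k).frz p.1).val p.2 * (uncurry ((M.frozen 0).sigmaIn k) p - uncurry ((M.frozen 0).sigmaOut k) p) := by
    funext p; rfl
  rw [e]
  exact hτ.mul (hin.sub (hout k))

/-- The core region is open. [folklore] -/
theorem WFBd.isOpen_core (h : M.WFBd Band) {k : ℕ} (hk : k < M.K) : IsOpen (M.core k) := by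
  have e : M.core k = {p : ℝ × E² | p.2 ∈ ((M.box k).frz p.1).inner} ∩ (M.frozen 0).inOne k ∩ (M.frozen 0).outZero k := by
    ext p; rfl
  rw [e]
  refine (((M.box k).isOpen_inner (h.smooth k hk)).inter ?_).inter ?_
  · by_cases h0 : k = 0
    · convert isOpen_univ (X := ℝ × E²); ext p; simp [ChainData.inOne, h0]
    · have hop := (M.J (k - 1)).isOpen_arg_gt (h.pos_continuous (j := k - 1) (by omega)) (2 / 3)
      convert hop using 1; ext p; simp [ChainData.inOne, h0]
  · by_cases hk1 : k + 1 < M.K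
    · have hop := (M.J k).isOpen_arg_lt (h.pos_continuous hk1) (1 / 3)
      convert hop using 1; ext p; simp [ChainData.outZero, hk1]
    · convert isOpen_univ (X := ℝ × E²); ext p; simp [ChainData.outZero, hk1]

/-- The junction region is open. [folklore] -/
theorem WFBd.isOpen_juncCut (h : M.WFBd Band) {k : ℕ} (hk : k + 1 < M.K) : IsOpen (M.juncCut k) := by
  have e : M.juncCut k = ({p : ℝ × E² | p.2 ∈ ((M.box k).frz p.1).inner} ∩ {p | p.2 ∈ ((M.box (k + 1)).frz p.1).inner}) ∩
      (M.frozen 0).inOne k ∩ (M.frozen 0).outZero (k + 1) := by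
    ext p
    simp only [juncCut, ChainData.juncCut, mem_setOf_eq, mem_inter_iff, frozen_B]
    rfl
  rw [e]
  refine ((((M.box k).isOpen_inner (h.smooth k (by omega))).inter
    ((M.box (k + 1)).isOpen_inner (h.smooth (k + 1) hk))).inter ?_).inter ?_
  · by_cases h0 : k = 0
    · convert isOpen_univ (X := ℝ × E²); ext p; simp [ChainData.inOne, h0]
    · have hop := (M.J (k - 1)).isOpen_arg_gt (h.pos_continuous (j := k - 1) (by omega)) (2 / 3)
      convert hop using 1; ext p; simp [ChainData.inOne, h0]
  · by_cases hk2 : k + 2 < M.K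
    · have hop := (M.J (k + 1)).isOpen_arg_lt (h.pos_continuous hk2) (1 / 3)
      convert hop using 1; ext p; simp [ChainData.outZero, hk2]
    · convert isOpen_univ (X := ℝ × E²); ext p; simp [ChainData.outZero, hk2]

/-- The tube box is closed. [folklore] -/
theorem WFBd.isClosed_tubeBox (h : M.WFBd Band) {k : ℕ} (hk : k < M.K) : IsClosed (M.tubeBox k) := by
  have e : M.tubeBox k = {p : ℝ × E² | p.2 ∈ ((M.box k).frz p.1).supp} ∩
      {p | k = 0 ∨ 1 / 3 ≤ (M.J (k - 1)).arg p.1 p.2} ∩ {p | k + 1 < M.K → (M.J k).arg p.1 p.2 ≤ 2 / 3} := by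
    ext p; rfl
  rw [e]
  refine (((M.box k).isClosed_supp (h.smooth k hk)).inter ?_).inter ?_
  · by_cases h0 : k = 0
    · convert isClosed_univ (X := ℝ × E²); ext p; simp [h0]
    · have hcl := (M.J (k - 1)).isClosed_arg_ge (h.pos_continuous (j := k - 1) (by omega)) (1 / 3)
      convert hcl using 1; ext p; simp [h0]
  · by_cases hk1 : k + 1 < M.K
    · have hcl := (M.J k).isClosed_arg_le (h.pos_continuous hk1) (2 / 3)
      convert hcl using 1; ext p; simp [hk1]
    · convert isClosed_univ (X := ℝ × E²); ext p; simp [hk1]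

/-! ## Frozen identities at the current time -/

/-- The inner box hypothesis of a space-time core point, for the fully frozen chain. [folklore] -/
theorem mem_inner_of_mem_core {k : ℕ} {p : ℝ × E²} (hp : p ∈ M.core k) : p.2 ∈ ((M.frozenAt p.1).B k).inner := hp.1.1

/-- On a core point the in-step of the fully frozen chain is `1`. [folklore] -/
theorem frozenAt_sigmaIn_eq_one {k : ℕ} (hk : k < M.K) {p : ℝ × E²} (hp : p ∈ (M.frozen p.1).inOne k) :
    (M.frozenAt p.1).sigmaIn k p.1 p.2 = 1 := by
  rw [frozenAt_sigmaIn]; exact (M.frozen p.1).sigmaIn_eq_one_of_mem hk hp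

/-- On an out-zero point the out-step of the fully frozen chain is `0`. [folklore] -/
theorem frozenAt_sigmaOut_eq_zero {k : ℕ} {p : ℝ × E²} (hp : p ∈ (M.frozen p.1).outZero k) :
    (M.frozenAt p.1).sigmaOut k p.1 p.2 = 0 := by
  rw [frozenAt_sigmaOut]; exact (M.frozen p.1).sigmaOut_eq_zero_of_mem hp

/-- **Core identities** of the moving cut-offs, from the fully frozen chain. [folklore] -/
theorem WFBd.chi_core (h : M.WFBd Band) {k : ℕ} (hk : k < M.K) {p : ℝ × E²} (hp : p ∈ M.core k) :
    M.chi k p.1 p.2 = 1 ∧ ∀ j < M.K, j ≠ k → M.chi j p.1 p.2 = 0 := by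
  have hc := (h.frozenAt p.1).chi_core hk (mem_inner_of_mem_core hp) (frozenAt_sigmaIn_eq_one hk hp.1.2)
    (frozenAt_sigmaOut_eq_zero hp.2)
  simp only [frozenAt_chi, frozenAt_K] at hc
  exact hc

/-- **Junction identities** of the moving cut-offs, from the fully frozen chain. [folklore] -/
theorem WFBd.chi_junction (h : M.WFBd Band) {k : ℕ} (hk : k + 1 < M.K) {p : ℝ × E²} (hp : p ∈ M.juncCut k) :
    M.chi k p.1 p.2 + M.chi (k + 1) p.1 p.2 = 1 ∧ ∀ j < M.K, j ≠ k → j ≠ k + 1 → M.chi j p.1 p.2 = 0 := by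
  have hc := (h.frozenAt p.1).chi_junction hk hp.1.1.1 hp.1.1.2
    (frozenAt_sigmaIn_eq_one (by simpa using by omega) hp.1.2) (frozenAt_sigmaOut_eq_zero hp.2)
  simp only [frozenAt_chi, frozenAt_K] at hc
  exact hc

/-- A cut-off vanishes off its current support box. [folklore] -/
theorem WFBd.chi_eq_zero_of_not_mem (h : M.WFBd Band) {k : ℕ} (hk : k < M.K) {t : ℝ} {z : E²}
    (hz : z ∉ ((M.box k).frz t).supp) : M.chi k t z = 0 := by
  have h0 := (h.frozenAt t).chi_eq_zero_of_not_mem hk (t := t) hz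
  rwa [frozenAt_chi] at h0

/-- **`χ_k Θ_k ≠ 0` only on the tube box ∩ band.** [folklore] -/
theorem WFBd.mem_tubeBox_of_mul_ne_zero (h : M.WFBd Band) {Θ : ℕ → ℝ → E² → ℝ}
    (hband : ∀ k < M.K, ∀ p : ℝ × E², Θ k p.1 p.2 ≠ 0 → p ∈ Band k) {k : ℕ} (hk : k < M.K) {p : ℝ × E²}
    (hne : M.chi k p.1 p.2 * Θ k p.1 p.2 ≠ 0) : p ∈ M.tubeBox k ∩ Band k := by
  -- apply the frozen statement to the time-shifted scalars `Θ' j t z := Θ j p.1 z`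
  have hband' : ∀ j < (M.frozenAt p.1).K, ∀ q : ℝ × E², (fun j (_ : ℝ) z => Θ j p.1 z) j q.1 q.2 ≠ 0 →
      q ∈ bandSlice Band p.1 j := by
    intro j hj q hq
    exact hband j hj (p.1, q.2) hq
  have hne' : (M.frozenAt p.1).chi k p.1 p.2 * (fun j (_ : ℝ) z => Θ j p.1 z) k p.1 p.2 ≠ 0 := by
    rwa [frozenAt_chi]
  have hm := (h.frozenAt p.1).mem_tubeBox_of_mul_ne_zero (Θ := fun j (_ : ℝ) z => Θ j p.1 z) hband' hk hne'
  exact ⟨hm.1, hm.2⟩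

/-! ## Region data and the move -/

section Move

variable {Θ H : ℕ → ℝ → E² → ℝ} {Agree : ℕ → Set (ℝ × E²)} {S : Set ℝ} {Q : Set E²} {H₀ Mb : ℝ}

/-- **Region data from a diagonally well-formed moving chain.** [folklore] -/
theorem WFBd.isRegionData (h : M.WFBd Band)
    (hband : ∀ k < M.K, ∀ p : ℝ × E², Θ k p.1 p.2 ≠ 0 → p ∈ Band k)
    (hAo : ∀ k, k + 1 < M.K → IsOpen (Agree k))
    (hAΘ : ∀ k, k + 1 < M.K → ∀ p ∈ Agree k, Θ (k + 1) p.1 p.2 = Θ k p.1 p.2)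
    (hAH : ∀ k, k + 1 < M.K → ∀ p ∈ Agree k, H (k + 1) p.1 p.2 = H k p.1 p.2)
    (hcover : ∀ t ∈ S, ∀ z ∈ Q, ∀ k < M.K, (t, z) ∈ M.tubeBox k ∩ Band k →
      (t, z) ∈ M.core k ∨ (0 < k ∧ (t, z) ∈ M.juncCut (k - 1) ∩ Agree (k - 1)) ∨
        (k + 1 < M.K ∧ (t, z) ∈ M.juncCut k ∩ Agree k)) :
    IsRegionData M.K M.chi Θ H M.core (fun k => M.juncCut k ∩ Agree k) (fun k => M.tubeBox k ∩ Band k) S Q where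
  isOpen_core k hk := h.isOpen_core hk
  isOpen_junc k hk := (h.isOpen_juncCut hk).inter (hAo k hk)
  isClosed_tube j hj := (h.isClosed_tubeBox hj).inter (h.isClosed_band j hj)
  core_one k hk p hp := (h.chi_core hk hp).1
  core_zero k hk p hp j hj hjk := (h.chi_core hk hp).2 j hj hjk
  junc_sum k hk p hp := (h.chi_junction hk hp.1).1
  junc_zero k hk p hp j hj hjk hjk1 := (h.chi_junction hk hp.1).2 j hj hjk hjk1
  junc_scalar k hk p hp := hAΘ k hk p hp.2
  junc_stream k hk p hp := hAH k hk p hp.2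
  tube j hj p hne := h.mem_tubeBox_of_mul_ne_zero hband hj hne
  cover t ht z hz hex := by
    obtain ⟨j, hj, hmem⟩ := hex
    rcases hcover t ht z hz j hj hmem with hc | ⟨hj0, hju⟩ | ⟨hj1, hju⟩
    · exact Or.inl ⟨j, hj, hc⟩
    · exact Or.inr ⟨j - 1, by omega, by
        have e : j - 1 + 1 = j := by omega
        simpa only using hju⟩
    · exact Or.inr ⟨j, hj1, hju⟩

/-- **Element facts for a moving chain** (the `K`-indexed data of `ChainData.BandedFacts`, stated
without reference to a frozen chain). [folklore] -/
structure Facts (M : MovingChain) (Θ H : ℕ → ℝ → E² → ℝ) (Mb : ℝ) (Band : ℕ → Set (ℝ × E²)) : Prop where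
  /-- `Θ_k ∈ C^∞(ℝ × ℝ²)` -/
  smooth_scalar : ∀ k < M.K, ContDiff ℝ ∞ (uncurry (Θ k))
  /-- `H_k ∈ C^∞(ℝ × ℝ²)` -/
  smooth_stream : ∀ k < M.K, ContDiff ℝ ∞ (uncurry (H k))
  /-- `Θ_k` is transported by `∇⊥H_k` everywhere -/
  transport : ∀ k < M.K, ∀ (t : ℝ) (z : E²),
    deriv (fun s => Θ k s z) t + fderiv ℝ (Θ k t) z (perpGrad (H k t) z) = 0
  /-- `|Θ_k| ≤ Mb` -/
  abs_le : ∀ k < M.K, ∀ (t : ℝ) (z : E²), |Θ k t z| ≤ Mb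
  /-- the bound is nonnegative -/
  M_nonneg : 0 ≤ Mb
  /-- `Θ_k ≠ 0` only on the band -/
  band : ∀ k < M.K, ∀ p : ℝ × E², Θ k p.1 p.2 ≠ 0 → p ∈ Band k

/-- **Junction agreement for a moving chain.** [folklore] -/
structure Agreement (M : MovingChain) (Θ H : ℕ → ℝ → E² → ℝ) (Agree : ℕ → Set (ℝ × E²)) : Prop where
  /-- agreement regions are open -/
  isOpen : ∀ k, k + 1 < M.K → IsOpen (Agree k)
  /-- scalars agree -/
  scalar : ∀ k, k + 1 < M.K → ∀ p ∈ Agree k, Θ (k + 1) p.1 p.2 = Θ k p.1 p.2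
  /-- stream functions agree -/
  stream : ∀ k, k + 1 < M.K → ∀ p ∈ Agree k, H (k + 1) p.1 p.2 = H k p.1 p.2

/-- **The assembled scalar is smooth.** [folklore] -/
theorem WFBd.contDiff_uncurry_scalar (h : M.WFBd Band) (hE : M.Facts Θ H Mb Band) :
    ContDiff ℝ ∞ (uncurry (assembledScalar M.K M.chi Θ)) :=
  contDiff_uncurry_assembledScalar M.K M.chi Θ (fun _ hk => h.contDiff_uncurry_chi hk) hE.smooth_scalar

/-- **The assembled stream function is smooth.** [folklore] -/
theorem WFBd.contDiff_uncurry_stream (h : M.WFBd Band) (hE : M.Facts Θ H Mb Band) :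
    ContDiff ℝ ∞ (uncurry (assembledStream M.K H₀ M.chi H)) :=
  contDiff_uncurry_assembledStream M.K H₀ M.chi H (fun _ hk => h.contDiff_uncurry_chi hk) hE.smooth_stream

/-- **The assembled velocity is smooth.** [folklore] -/
theorem WFBd.contDiff_uncurry_velocity (h : M.WFBd Band) (hE : M.Facts Θ H Mb Band) :
    ContDiff ℝ ∞ (uncurry (assembledVelocity M.K H₀ M.chi H)) :=
  contDiff_uncurry_assembledVelocity M.K H₀ M.chi H (fun _ hk => h.contDiff_uncurry_chi hk) hE.smooth_stream

/-- **The assembled velocity is divergence free everywhere.** [folklore] -/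
theorem WFBd.divergence_velocity (h : M.WFBd Band) (hE : M.Facts Θ H Mb Band) (t : ℝ) (z : E²) :
    ∑ j, fderiv ℝ (assembledVelocity M.K H₀ M.chi H t) z (EuclideanSpace.single j 1) j = 0 :=
  divergence_assembledVelocity M.K H₀ M.chi H (fun _ hk => h.contDiff_uncurry_chi hk) hE.smooth_stream t z

/-- **Transport of the move on `S × Q`.** [folklore] -/
theorem WFBd.transport_move (h : M.WFBd Band) (hE : M.Facts Θ H Mb Band) (hA : M.Agreement Θ H Agree)
    (hcover : ∀ t ∈ S, ∀ z ∈ Q, ∀ k < M.K, (t, z) ∈ M.tubeBox k ∩ Band k →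
      (t, z) ∈ M.core k ∨ (0 < k ∧ (t, z) ∈ M.juncCut (k - 1) ∩ Agree (k - 1)) ∨
        (k + 1 < M.K ∧ (t, z) ∈ M.juncCut k ∩ Agree k)) :
    ∀ t ∈ S, ∀ z ∈ Q, deriv (fun s => assembledScalar M.K M.chi Θ s z) t +
      fderiv ℝ (assembledScalar M.K M.chi Θ t) z (assembledVelocity M.K H₀ M.chi H t z) = 0 :=
  transport_assembled_of_regions (h.isRegionData hE.band hA.isOpen hA.scalar hA.stream hcover)
    fun k hk t _ z _ => hE.transport k hk t z

/-- **The bound of the move on `S × Q`.** [folklore] -/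
theorem WFBd.abs_scalar_le (h : M.WFBd Band) (hE : M.Facts Θ H Mb Band) (hA : M.Agreement Θ H Agree)
    (hcover : ∀ t ∈ S, ∀ z ∈ Q, ∀ k < M.K, (t, z) ∈ M.tubeBox k ∩ Band k →
      (t, z) ∈ M.core k ∨ (0 < k ∧ (t, z) ∈ M.juncCut (k - 1) ∩ Agree (k - 1)) ∨
        (k + 1 < M.K ∧ (t, z) ∈ M.juncCut k ∩ Agree k)) :
    ∀ t ∈ S, ∀ z ∈ Q, |assembledScalar M.K M.chi Θ t z| ≤ Mb :=
  abs_assembledScalar_le_of_regions (h.isRegionData hE.band hA.isOpen hA.scalar hA.stream hcover) hE.M_nonneg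
    fun k hk t _ z _ => hE.abs_le k hk t z

/-- **The assembled velocity vanishes off the current support boxes.** [folklore] -/
theorem WFBd.velocity_eq_zero_off_boxes (h : M.WFBd Band) {t : ℝ} {z : E²}
    (hz : ∀ k < M.K, z ∉ ((M.box k).frz t).supp) : assembledVelocity M.K H₀ M.chi H t z = 0 := by
  refine assembledVelocity_eq_zero_off_streamTubes (TubeH := fun k => {p : ℝ × E² | p.2 ∈ ((M.box k).frz p.1).supp})
    (fun k hk => (M.box k).isClosed_supp (h.smooth k hk)) (fun k hk p hne => ?_) fun k hk hmem => hz k hk hmem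
  by_contra hp
  exact hne (by rw [h.chi_eq_zero_of_not_mem hk hp, zero_mul])

/-- **The assembled scalar vanishes off the current support boxes.** [folklore] -/
theorem WFBd.scalar_eq_zero_off_boxes (h : M.WFBd Band) {t : ℝ} {z : E²}
    (hz : ∀ k < M.K, z ∉ ((M.box k).frz t).supp) : assembledScalar M.K M.chi Θ t z = 0 := by
  rw [assembledScalar_apply]
  exact Finset.sum_eq_zero fun k hk => by
    rw [h.chi_eq_zero_of_not_mem (Finset.mem_range.1 hk) (hz k (Finset.mem_range.1 hk)), zero_mul]

/-- **The assembled scalar vanishes off the tubes** (tube box ∩ band). [folklore] -/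
theorem WFBd.scalar_eq_zero_off_tubes (h : M.WFBd Band) (hE : M.Facts Θ H Mb Band) {t : ℝ} {z : E²}
    (hz : ∀ k < M.K, (t, z) ∉ M.tubeBox k ∩ Band k) : assembledScalar M.K M.chi Θ t z = 0 :=
  assembledScalar_eq_zero_off_tubes (Tube := fun k => M.tubeBox k ∩ Band k)
    (fun _ hk _ hne => h.mem_tubeBox_of_mul_ne_zero hE.band hk hne) hz

/-- **On the core of an element the move is that element.** [folklore] -/
theorem WFBd.move_eq_of_core (h : M.WFBd Band) {k : ℕ} (hk : k < M.K) {t : ℝ} {z : E²} (hp : (t, z) ∈ M.core k) :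
    assembledScalar M.K M.chi Θ t z = Θ k t z ∧ assembledVelocity M.K H₀ M.chi H t z = perpGrad (H k t) z := by
  have hopen := h.isOpen_core hk
  have h1 : ∀ᶠ p in 𝓝 (t, z), M.chi k p.1 p.2 = 1 :=
    eventually_of_mem_open (P := fun s w => M.chi k s w = 1) hopen hp fun p hp' => (h.chi_core hk hp').1
  have h0 : ∀ j < M.K, j ≠ k → ∀ᶠ p in 𝓝 (t, z), M.chi j p.1 p.2 = 0 := fun j hj hjk =>
    eventually_of_mem_open (P := fun s w => M.chi j s w = 0) hopen hp fun p hp' => (h.chi_core hk hp').2 j hj hjk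
  exact assembled_eq_prescribed_of_core (Θg := Θ k) (Hg := H k) hk h1 h0 (Eventually.of_forall fun _ => rfl)
    (Eventually.of_forall fun _ => rfl)

/-- **Agreement with a prescribed pair on a core** (gate windows). [folklore] -/
theorem WFBd.move_eq_prescribed_of_core (h : M.WFBd Band) {k : ℕ} (hk : k < M.K) {Θg Hg : ℝ → E² → ℝ}
    (hΘ : ∀ p ∈ M.core k, Θ k p.1 p.2 = Θg p.1 p.2) (hH : ∀ p ∈ M.core k, H k p.1 p.2 = Hg p.1 p.2)
    {t : ℝ} {z : E²} (hp : (t, z) ∈ M.core k) :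
    assembledScalar M.K M.chi Θ t z = Θg t z ∧ assembledVelocity M.K H₀ M.chi H t z = perpGrad (Hg t) z := by
  have hopen := h.isOpen_core hk
  have h1 : ∀ᶠ p in 𝓝 (t, z), M.chi k p.1 p.2 = 1 :=
    eventually_of_mem_open (P := fun s w => M.chi k s w = 1) hopen hp fun p hp' => (h.chi_core hk hp').1
  have h0 : ∀ j < M.K, j ≠ k → ∀ᶠ p in 𝓝 (t, z), M.chi j p.1 p.2 = 0 := fun j hj hjk =>
    eventually_of_mem_open (P := fun s w => M.chi j s w = 0) hopen hp fun p hp' => (h.chi_core hk hp').2 j hj hjk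
  exact assembled_eq_prescribed_of_core hk h1 h0
    (eventually_of_mem_open (P := fun s w => Θ k s w = Θg s w) hopen hp hΘ)
    (eventually_of_mem_open (P := fun s w => H k s w = Hg s w) hopen hp hH)

end Move

end MovingChain

end PlanarKinematics

end Literature.Analysis.FluidPDE
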